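import Literature.Computability.QuantumComplexity.GRData
import Literature.Computability.QuantumComplexity.GenKitWords
import Literature.Computability.QuantumComplexity.CleanXorDesc
import Literature.Computability.QuantumComplexity.CoreDescBlockFP
import HarnessLib

/-!
# The gadget input wires of the Grover–Rudolph levels (target and flag bits), in closed form and on codes

Topic `Literature/Computability/QuantumComplexity`; an input of the S3 stage word of the UNIFORMITY of Regev's sampler
([Regev2009, Lemma 3.14, proof]; Arora–Barak §6.2). The flag program of level `j` reads the wires
`GRWord.insGR (ws j) (fsEmb (D.hG j))` — the rotated point wire and the `kk` output bits of the clean cosine block — and the plug lemma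
`GenKit.grOpsA_codeFP_of` (`GRKitPlugFP.lean`) asks for their VALUES `(insGR …).map Fin.val` on codes. For the standard block data of
`GRData.lean` (machine data `m : GRData.Mach ℓ np wlen kk a`, base `ℓ + np`, `ws j = j`) this file proves the closed form

  `(insGR (ws j) (fsEmb (conjGeom m hk1 j))).map val = j :: (List.range kk).map (fun b => ℓ + np + (resW m.e m.M (j + np + |m.v j|) b ⊤ − (j + np)))`

(`GRData.fsEmb_val`, **`GRData.insGR_val_eq`**; `⊤ = CWrap.symTrue m.M`, `resW = NN + (b·A₁ + eA ⊤)` of `RevUncompute.lean`) and puts the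
right-hand side on codes for a FIXED machine `(e, M)` in an indexed context: **`GRData.insValsStd_codeFP_of`**
`(hℓ hnp hk : unE-valued) (hN : CodeFP (pairE eσ natE) unE (fun q => q.2 + np q.1 + (v q.1 q.2).length)) :
CodeFP (pairE eσ natE) (rawE natE) (fun q => q.2 :: (List.range (kk q.1)).map …)` (from `RevSim.NN_codeFP`, `CleanXorDesc.lean`) — exactly the
`hins` of `GenKit.grOpsA_codeFP_of` with `ι = ℕ` (the level). Everything is proved; no named fact is introduced.

## References

* O. Regev, J. ACM 56(6) (2009), Lemma 3.12 (proof), Lemma 3.14 (proof) [Regev2009].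
* S. Arora, B. Barak, *Computational Complexity: A Modern Approach*, CUP 2009, §6.2 [AroraBarak2009].
* C. H. Bennett, *Logical reversibility of computation*, IBM J. Res. Dev. 17 (1973), §3 [Bennett1973].
-/

noncomputable section

namespace Literature.Computability.QuantumComplexity

open _root_.Computability Cryptography Complexity Complexity.CodeFP SLP RevDesc AJLCore RevSim RevClean

namespace GRData

section Values

variable {ℓ np wlen kk : ℕ} {a : Fin ℓ → (Fin ℓ → Bool) → ℝ} (m : Mach ℓ np wlen kk a) (hk1 : 1 ≤ kk)

/-- **The value of flag-bit wire `b` of level `j`**: the result cell of output bit `b` of the clean block, placed from `ℓ + np`. [folklore] -/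
theorem fsEmb_val (j : Fin ℓ) (b : Fin kk) : (GRWord.fsEmb (conjGeom m hk1 j) b : ℕ) =
    ℓ + np + (resW m.e m.M (j + np + (m.v j).length) b (CWrap.symTrue m.M) - (j + np)) := by
  have hG := conjGeom m hk1 j
  have htop := top_le m j
  have hwin := GRWord.fsW_window hG b.2
  have e : GRWord.fsEmb hG b = dw ℓ np wlen kk ⟨ℓ + np + (resW m.e m.M (j + np + (m.v j).length) b (CWrap.symTrue m.M) - (j + np)), by omega⟩ :=
    finOf_eq_dw ℓ np wlen kk (by omega) (kit ℓ np wlen kk).hN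
  rw [e, dw_val]

/-- **The gadget input values of level `j` in closed form.** [cite: Regev2009, Lemma 3.12 (proof)] -/
theorem insGR_val_eq (j : Fin ℓ) : (GRWord.insGR (ws ℓ np wlen kk j) (GRWord.fsEmb (conjGeom m hk1 j))).map Fin.val =
    (j : ℕ) :: (List.range kk).map (fun b => ℓ + np + (resW m.e m.M (j + np + (m.v j).length) b (CWrap.symTrue m.M) - (j + np))) := by
  rw [GRWord.insGR, List.map_cons, ws_val]
  congr 1
  change List.map Fin.val (List.ofFn fun b : Fin kk => GRWord.fsEmb (conjGeom m hk1 j) b) = _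
  rw [List.map_ofFn, List.ofFn_eq_map, ← List.map_coe_finRange_eq_range, List.map_map]
  exact List.map_congr_left fun b _ => fsEmb_val m hk1 j b

end Values

variable {σ : Type} {eσ : σ → List Bool} (e : ℕ) (M : Turing.TM2ComputableAux Bool Bool) {ℓ np kk : σ → ℕ} {v : σ → ℕ → List Bool}
  (hℓ : CodeFP eσ unE ℓ) (hnp : CodeFP eσ unE np) (hk : CodeFP eσ unE kk) (hN : CodeFP (pairE eσ natE) unE (fun q => q.2 + np q.1 + (v q.1 q.2).length))
include hℓ hnp hk hN

/-- **The standard gadget input values on codes** (fixed machine; context `c`, level `j`): the shape `GenKit.grOpsA_codeFP_of` consumes.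
[cite: Regev2009, Lemma 3.14 (proof)] [cite: AroraBarak2009, §6.2 (proof of Thm. 6.15)] -/
theorem insValsStd_codeFP_of : CodeFP (pairE eσ natE) (rawE natE) (fun q => q.2 :: (List.range (kk q.1)).map
    (fun b => ℓ q.1 + np q.1 + (resW e M (q.2 + np q.1 + (v q.1 q.2).length) b (CWrap.symTrue M) - (q.2 + np q.1)))) := by
  have hNN : CodeFP (pairE eσ natE) natE (fun q => NN e M (q.2 + np q.1 + (v q.1 q.2).length)) := ((NN_codeFP e M).comp hN :)
  have hL : CodeFP (pairE eσ natE) natE (fun q => ℓ q.1 + np q.1) := natAdd.comp ((BP.toNat (hℓ.comp (fst _ _))).pair (BP.toNat (hnp.comp (fst _ _))))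
  have hn0 : CodeFP (pairE eσ natE) natE (fun q => q.2 + np q.1) := natAdd.comp ((snd _ _).pair (BP.toNat (hnp.comp (fst _ _))))
  have hg : CodeFP (pairE (pairE eσ natE) natE) natE (fun t => ℓ t.1.1 + np t.1.1 +
      (NN e M (t.1.2 + np t.1.1 + (v t.1.1 t.1.2).length) + (t.2 * A₁ M + (eA M (CWrap.symTrue M) : ℕ)) - (t.1.2 + np t.1.1))) :=
    (natAdd.comp ((hL.comp (fst _ _)).pair (natSub.comp ((natAdd.comp ((hNN.comp (fst _ _)).pair (natAdd.comp ((natMul.comp ((snd _ _).pair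
      (const _ (A₁ M)))).pair (const _ (eA M (CWrap.symTrue M) : ℕ)))))).pair (hn0.comp (fst _ _))))) :)
  exact ((rawCons natE).comp ((snd _ _).pair ((map hg).comp ((CodeFP.id _).pair (urange.comp (hk.comp (fst _ _))))))).congr fun _ => rfl

end GRData

end Literature.Computability.QuantumComplexity

end
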